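import Literature.Probability.RandomPlanarGeometry.SLEPointFlowStopped
import Literature.Probability.RandomPlanarGeometry.SLEPointFlowStop
import Literature.Analysis.FunctionSpaces.ItoMartingale
import HarnessLib

/-!
# The real part of the SLE_κ flow of a point of `ℍ` does not loiter in a bounded interval

Topic `Probability/RandomPlanarGeometry`; theorems (and one stopping time). A step towards the
interior-point case of S. Rohde, O. Schramm, *Basic properties of SLE*, Ann. of Math. 161 (2005),
**Lemma 6.5** (p. 906: "Let `z ∈ ℍ̄ ∖ {0}`. If `κ > 4`, then `P[τ(z) < ∞] = 1`"). The printed proof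
(p. 907) needs, besides the optional sampling of the local martingale `h(gₜ(z) - ξ(t))`, the fact
that the centred flow `zₜ = xₜ + i yₜ = gₜ(z) - ξ(t)` cannot stay bounded for a long time
("`P[τ_R > T] < ε/2`" for `T` large), which Rohde–Schramm obtain from the "sprint times" of the
Brownian motion. Here this non-loitering statement is proved instead from the Itô calculus of the
real part already in the tree: with `dxₜ = 2xₜ|zₜ|⁻² dt - dξ(t)` (p. 907;
`isItoProcess_stoppedProcess_slePointRe`), Itô's formula for `x²`
(`Literature.Analysis.FunctionSpaces.martingale_apply_sub_timeIntegral`) shows that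
`x²_{t∧σ} - ∫₀^{t∧σ} (4x²/|z|² + κ) ds` is a martingale for the stopping time
`σ = σ_{R,n}` = (exit of `x` from `(-R, R)`) `∧ ρₙ` (`ρₙ` the localizing times of `SLEPointFlow`),
whence **`κ t · P[σ_{R,n} ≥ t] ≤ E[x²_{t∧σ}] - (re z)² ≤ R² - (re z)²`** uniformly in `n`
(`measureReal_coe_le_slePointReExitTime_le`), and therefore

* `measure_swallowingTime_eq_top_and_forall_abs_re_lt_eq_zero` — **for `κ > 0`, `z ∈ ℍ` and
  `R > |re z|`, almost surely it is not the case that `τ(z) = ∞` while `|xₜ| < R` for all `t`**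
  (on that event `σ_{R,n} = ρₙ ↑ ∞`).

No named facts are introduced; `κ > 4` is not needed for this step.

## References

* S. Rohde, O. Schramm, *Basic properties of SLE*, Ann. of Math. 161 (2005), Lemma 6.5 and its
  proof (pp. 906–907).
* D. Revuz, M. Yor, *Continuous Martingales and Brownian Motion* (1999), Ch. IV, Thm (3.3).
-/

noncomputable section

open MeasureTheory Filter Set
open scoped NNReal ENNReal Topology

namespace Literature.Probability.RandomPlanarGeometry

open Loewner Literature.Probability.Process Literature.Analysis.FunctionSpaces

variable {κ : ℝ≥0} {z : ℂ} {R : ℝ} {n : ℕ}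

/-! ### The stopping time `σ_{R,n}`: exit of `x` from `(-R, R)`, capped by `ρₙ` -/

variable (κ z R n) in
/-- **`σ_{R,n} = (exit time of x^{ρₙ} from (-R, R)) ∧ ρₙ`**: the first exit of the real part
`xₜ = re(gₜ(z) - Wₜ)` of the SLE_κ flow of `z` from `(-R, R)`, computed on the localized path
`x^{ρₙ}` (`slePointReStop`, continuous) and capped by the localizing time `ρₙ = slePointLocTime κ z n`
(a version of Rohde–Schramm's `τ_R ∧ T`, proof of Lemma 6.5, with the real part in place of `|zₜ|`).
[cite: RohdeSchramm2005, Lemma 6.5 (proof)] -/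
def slePointReExitTime (ω : ℝ≥0 → ℝ) : WithTop ℝ≥0 :=
  min (exitTime (slePointReStop κ z n) (-R) R ω) (slePointLocTime κ z n ω)

/-- `σ_{R,n} ≤ ρₙ`. [folklore] -/
theorem slePointReExitTime_le_locTime (ω : ℝ≥0 → ℝ) :
    slePointReExitTime κ z R n ω ≤ slePointLocTime κ z n ω := min_le_right _ _

/-- `σ_{R,n}` is at most the exit time of `x^{ρₙ}` from `(-R, R)`. [folklore] -/
theorem slePointReExitTime_le_exitTime (ω : ℝ≥0 → ℝ) :
    slePointReExitTime κ z R n ω ≤ exitTime (slePointReStop κ z n) (-R) R ω := min_le_left _ _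

/-- `x^{ρₙ}` is adapted to the raw Brownian filtration. [folklore] -/
theorem adapted_slePointReStop (κ : ℝ≥0) (hz : 0 < z.im) (n : ℕ) :
    Adapted brownianFiltration (slePointReStop κ z n) := fun t ↦
  (stronglyAdapted_slePointReStop κ hz n t).measurable

/-- **`σ_{R,n}` is a stopping time** of the raw Brownian filtration (exit time of a continuous
adapted process, `Literature.Probability.Process.isStoppingTime_exitTime`, and `ρₙ`). [folklore] -/
theorem isStoppingTime_slePointReExitTime (hz : 0 < z.im) :
    IsStoppingTime brownianFiltration (slePointReExitTime κ z R n) :=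
  (isStoppingTime_exitTime (adapted_slePointReStop κ hz n) (continuous_slePointReStop hz)).min
    (isStoppingTime_slePointLocTime κ hz n)

/-- **Up to `σ_{R,n}` the real part stays in `[-R, R]`** (`|re z| < R`): the flow stopped at
`σ_{R,n}` satisfies `|x^σ| ≤ R`. [folklore] -/
theorem abs_stoppedProcess_slePointRe_le (hz : 0 < z.im) (hR : |z.re| < R) (t : ℝ≥0)
    (ω : ℝ≥0 → ℝ) :
    |stoppedProcess (slePointRe κ z) (slePointReExitTime κ z R n) t ω| ≤ R := by
  set u : ℝ≥0 := (min (t : WithTop ℝ≥0) (slePointReExitTime κ z R n ω)).untopA with hu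
  have hu₁ : (u : WithTop ℝ≥0) ≤ exitTime (slePointReStop κ z n) (-R) R ω :=
    (coe_untopA_min_le t _).trans (slePointReExitTime_le_exitTime ω)
  have hu₂ : (u : WithTop ℝ≥0) ≤ slePointLocTime κ z n ω :=
    (coe_untopA_min_le t _).trans (slePointReExitTime_le_locTime ω)
  have h0 : slePointReStop κ z n 0 ω ∈ Ioo (-R) R := by
    rw [slePointReStop_zero hz]
    exact ⟨(abs_lt.1 hR).1, (abs_lt.1 hR).2⟩
  have hmem := stoppedProcess_exitTime_mem_Icc (continuous_slePointReStop hz ω) h0 u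
  rw [stoppedProcess_exitTime_eq_of_le hu₁, slePointReStop_eq_of_le hu₂] at hmem
  change |slePointRe κ z u ω| ≤ R
  exact abs_le.2 ⟨hmem.1, hmem.2⟩

/-! ### Itô's formula for `x²` up to `σ_{R,n}`: `κ t P[σ ≥ t] ≤ R² - (re z)²` -/

/-- **`κ t · P[σ_{R,n} ≥ t] ≤ R² - (re z)²`** for `κ > 0`, `z ∈ ℍ`, `|re z| < R` and every `n`,
`t > 0`. With `x = x^{σ}`, `σ = σ_{R,n}`, an Itô process with drift `𝟙_{s≤σ} 2x/|z|²` and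
diffusion `𝟙_{s≤σ}(-√κ)` (`isItoProcess_stoppedProcess_slePointRe`), Itô's formula for `u²`
(`martingale_apply_sub_timeIntegral`) makes `x_t² - ∫₀ᵗ 𝟙_{s≤σ}(4x_s²/|z_s|² + κ) ds` a
martingale started at `(re z)²`; the time integral is `≥ κ (t ∧ σ)`, which is `κ t` on `{σ ≥ t}`,
and `x_t² ≤ R²`. (Rohde–Schramm bound `P[τ_R > T]` by sprint times of the Brownian motion instead.)
[cite: RohdeSchramm2005, Lemma 6.5 (proof)] -/
theorem measureReal_coe_le_slePointReExitTime_le (hκ : 0 < κ) (hz : 0 < z.im) (hR : |z.re| < R)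
    (n : ℕ) (t : ℝ≥0) :
    (κ : ℝ) * t * preWienerMeasure.real {ω | (t : WithTop ℝ≥0) ≤ slePointReExitTime κ z R n ω} ≤
      R ^ 2 - z.re ^ 2 := by
  haveI := isProbabilityMeasure_preWienerMeasure'
  set σ := slePointReExitTime κ z R n with hσdef
  have hσ : IsStoppingTime brownianFiltration σ := isStoppingTime_slePointReExitTime hz
  have hσρ : ∀ ω, σ ω ≤ slePointLocTime κ z n ω := slePointReExitTime_le_locTime
  have hσ' : ∀ s : ℝ≥0, MeasurableSet[brownianFiltration s] {ω | σ ω < s} :=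
    fun s ↦ hσ.measurableSet_lt s
  -- the processes and coefficients
  set X : ℝ≥0 → (ℝ≥0 → ℝ) → ℝ := stoppedProcess (slePointRe κ z) σ with hXdef
  set Y : ℝ≥0 → (ℝ≥0 → ℝ) → ℝ := stoppedProcess (slePointIm κ z) σ with hYdef
  set bX : ℝ≥0 → (ℝ≥0 → ℝ) → ℝ := trunc σ (fun s ω ↦ loewnerReDrift (X s ω) (Y s ω)) with hbXdef
  set σB : ℝ≥0 → (ℝ≥0 → ℝ) → ℝ := trunc σ (fun _ _ ↦ -Real.sqrt κ) with hσBdef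
  set G : ℝ≥0 → (ℝ≥0 → ℝ) → ℝ := fun s ω ↦ 2 * X s ω * loewnerReDrift (X s ω) (Y s ω) + (κ : ℝ)
    with hGdef
  have hYpos : ∀ s ω, 0 < Y s ω := fun s ω ↦ stoppedProcess_slePointIm_pos hz hσρ s ω
  have hXc : ∀ ω, Continuous (X · ω) := fun ω ↦ continuous_stoppedProcess_slePointRe hz hσρ ω
  have hYc : ∀ ω, Continuous (Y · ω) := fun ω ↦ continuous_stoppedProcess_slePointIm hz σ ω
  have hXa : StronglyAdapted brownianFiltration X := stronglyAdapted_stoppedProcess_slePointRe hz hσ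
  have hXp : IsStronglyProgressive brownianFiltration X := hXa.isStronglyProgressive_of_continuous hXc
  have hbXp : IsStronglyProgressive brownianFiltration bX :=
    isStronglyProgressive_trunc (isStronglyProgressive_loewnerReDrift_stopped hz hσ) hσ'
  have hσBp : IsStronglyProgressive brownianFiltration σB :=
    isStronglyProgressive_trunc (isStronglyProgressive_const _ _) hσ'
  have hX : IsItoProcess X bX σB brownian brownianFiltration preWienerMeasure :=
    isItoProcess_stoppedProcess_slePointRe hz hσ hσρ
  have hX0 : ∀ ω, X 0 ω = z.re := fun ω ↦ stoppedProcess_slePointRe_zero hz ω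
  have hXmem : ∀ s ω, X s ω ∈ Icc (-R) R := fun s ω ↦
    abs_le.1 (abs_stoppedProcess_slePointRe_le hz hR s ω)
  have hσbd : ∀ s ω, |σB s ω| ≤ Real.sqrt κ := fun s ω ↦ by
    simp only [hσBdef, trunc_apply]
    split_ifs
    · rw [abs_neg, abs_of_nonneg (Real.sqrt_nonneg _)]
    · rw [abs_zero]; exact Real.sqrt_nonneg _
  -- Itô's formula for `u ↦ u²`
  have hf : ContDiff ℝ 2 (fun u : ℝ ↦ u ^ 2) := contDiff_id.pow 2
  have hd1 : ∀ v : ℝ, deriv (fun u : ℝ ↦ u ^ 2) v = 2 * v := by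
    intro v
    rw [(hasDerivAt_pow 2 v).deriv]
    simp [pow_one]
  have hd2 : ∀ v : ℝ, iteratedDeriv 2 (fun u : ℝ ↦ u ^ 2) v = 2 := by
    intro v
    rw [iteratedDeriv_succ, iteratedDeriv_one]
    have h1 : deriv (fun u : ℝ ↦ u ^ 2) = fun v ↦ 2 * v := funext hd1
    rw [h1, deriv_const_mul _ differentiableAt_id, deriv_id'', mul_one]
  have hmart := martingale_apply_sub_timeIntegral hf hXa hXc hbXp hσBp hX hX0 hXmem hσbd
  -- the Itô drift is the truncated process `G = 4x²/|z|² + κ`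
  have hdrift : (fun s ω ↦ bX s ω * deriv (fun u : ℝ ↦ u ^ 2) (X s ω) +
      2⁻¹ * σB s ω ^ 2 * iteratedDeriv 2 (fun u : ℝ ↦ u ^ 2) (X s ω)) = trunc σ G := by
    funext s ω
    rw [hd1, hd2]
    by_cases hs : (s : WithTop ℝ≥0) ≤ σ ω
    · simp only [hbXdef, hσBdef, hGdef, trunc_of_le hs, neg_sq, Real.sq_sqrt κ.coe_nonneg]
      ring
    · simp only [hbXdef, hσBdef, trunc_of_not_le hs]
      simp
  rw [hdrift] at hmart
  -- pathwise: `G ≥ κ`, so the time integral is at least `κ (t ∧ σ)`, `= κ t` on `{σ ≥ t}`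
  have hGge : ∀ s ω, (κ : ℝ) ≤ G s ω := fun s ω ↦ by
    simp only [hGdef, loewnerReDrift_apply]
    have hQ : 0 < X s ω ^ 2 + Y s ω ^ 2 := by positivity [hYpos s ω]
    have : 0 ≤ 2 * X s ω * (2 * X s ω / (X s ω ^ 2 + Y s ω ^ 2)) := by
      rw [show 2 * X s ω * (2 * X s ω / (X s ω ^ 2 + Y s ω ^ 2)) =
        4 * X s ω ^ 2 / (X s ω ^ 2 + Y s ω ^ 2) by ring]
      positivity
    linarith
  have hGcont : ∀ ω, Continuous fun r : ℝ ↦ G r.toNNReal ω := fun ω ↦ by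
    simp only [hGdef]
    refine ((continuous_const.mul ((hXc ω).comp continuous_real_toNNReal)).mul
      (continuous_loewnerReDrift_comp ((hXc ω).comp continuous_real_toNNReal)
        ((hYc ω).comp continuous_real_toNNReal) fun r ↦ hYpos _ ω)).add continuous_const
  have hTIge : ∀ ω, (t : WithTop ℝ≥0) ≤ σ ω → (κ : ℝ) * t ≤ timeIntegral (trunc σ G) t ω := by
    intro ω hω
    have hclock : (min (t : WithTop ℝ≥0) (σ ω)).untopA = t := by
      rw [min_eq_left hω, WithTop.untopA_eq_untop WithTop.coe_ne_top, WithTop.untop_coe]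
    rw [timeIntegral_trunc, hclock]
    simp only [timeIntegral]
    have hconst : ∫ _ in (0 : ℝ)..t, (κ : ℝ) = (κ : ℝ) * t := by
      rw [intervalIntegral.integral_const, sub_zero, smul_eq_mul, mul_comm]
    rw [← hconst]
    exact intervalIntegral.integral_mono_on t.coe_nonneg intervalIntegrable_const
      ((hGcont ω).intervalIntegrable _ _) fun r _ ↦ hGge _ ω
  have hTInonneg : ∀ ω, 0 ≤ timeIntegral (trunc σ G) t ω := by
    intro ω
    rw [timeIntegral_trunc]
    simp only [timeIntegral]
    refine intervalIntegral.integral_nonneg (NNReal.coe_nonneg _) fun r _ ↦ ?_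
    exact le_trans (by positivity) (hGge _ ω)
  -- integrability: the martingale and `X_t²`
  have hMint : Integrable (fun ω ↦ X t ω ^ 2 - timeIntegral (trunc σ G) t ω) preWienerMeasure :=
    hmart.integrable t
  have hXtm : Measurable fun ω ↦ X t ω := ((hXa t).mono (brownianFiltration.le t)).measurable
  have hX2bdd : ∀ ω, X t ω ^ 2 ≤ R ^ 2 := fun ω ↦ by
    have h := abs_stoppedProcess_slePointRe_le (κ := κ) (n := n) hz hR t ω
    have hR0 : 0 ≤ R := (abs_nonneg _).trans h
    calc X t ω ^ 2 = |X t ω| ^ 2 := (sq_abs _).symm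
      _ ≤ R ^ 2 := pow_le_pow_left₀ (abs_nonneg _) h 2
  have hX2int : Integrable (fun ω ↦ X t ω ^ 2) preWienerMeasure :=
    (integrable_const (R ^ 2)).mono' (hXtm.pow_const 2).aestronglyMeasurable
      (ae_of_all _ fun ω ↦ by
        rw [Real.norm_eq_abs, abs_of_nonneg (sq_nonneg _)]; exact hX2bdd ω)
  have hTIint : Integrable (fun ω ↦ timeIntegral (trunc σ G) t ω) preWienerMeasure := by
    have := hX2int.sub hMint
    refine this.congr (ae_of_all _ fun ω ↦ ?_)
    simp only [Pi.sub_apply, sub_sub_cancel]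
  -- `E[M_t] = (re z)²`
  have hEM : ∫ ω, (X t ω ^ 2 - timeIntegral (trunc σ G) t ω) ∂preWienerMeasure = z.re ^ 2 := by
    have h1 := hmart.setIntegral_eq (zero_le : (0 : ℝ≥0) ≤ t) (s := univ) MeasurableSet.univ
    rw [setIntegral_univ, setIntegral_univ] at h1
    rw [← h1]
    simp only [hX0, timeIntegral_apply_zero, sub_zero, integral_const, smul_eq_mul, probReal_univ,
      one_mul]
  have hETI : ∫ ω, timeIntegral (trunc σ G) t ω ∂preWienerMeasure ≤ R ^ 2 - z.re ^ 2 := by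
    have h2 : ∫ ω, X t ω ^ 2 ∂preWienerMeasure ≤ R ^ 2 := by
      have := integral_mono hX2int (integrable_const (R ^ 2)) fun ω ↦ hX2bdd ω
      rwa [integral_const, smul_eq_mul, probReal_univ, one_mul] at this
    rw [integral_sub hX2int hTIint] at hEM
    linarith
  -- Markov on the event `{σ ≥ t}`
  set A : Set (ℝ≥0 → ℝ) := {ω | (t : WithTop ℝ≥0) ≤ σ ω} with hAdef
  have hAm : MeasurableSet A := brownianFiltration.le t _ (hσ.measurableSet_ge t)
  have hind : ∫ ω, A.indicator (fun _ ↦ (κ : ℝ) * t) ω ∂preWienerMeasure =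
      (κ : ℝ) * t * preWienerMeasure.real A := by
    rw [integral_indicator_const _ hAm, smul_eq_mul, mul_comm]
  rw [← hind]
  refine le_trans (integral_mono ((integrable_const _).indicator hAm) hTIint fun ω ↦ ?_) hETI
  by_cases hω : ω ∈ A
  · rw [indicator_of_mem hω]
    exact hTIge ω hω
  · rw [indicator_of_notMem hω]
    exact hTInonneg ω

/-! ### Non-loitering of the real part -/

/-- If `|xₛ| < R` for all `s`, the localized path `x^{ρₙ}` never leaves `(-R, R)`, so its exit
time is `⊤` and `σ_{R,n} = ρₙ`. [folklore] -/
theorem slePointReExitTime_eq_locTime_of_forall_abs_lt {ω : ℝ≥0 → ℝ}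
    (h : ∀ s : ℝ≥0, |slePointRe κ z s ω| < R) :
    slePointReExitTime κ z R n ω = slePointLocTime κ z n ω := by
  have htop : exitTime (slePointReStop κ z n) (-R) R ω = ⊤ := by
    rw [exitTime_def]
    refine hittingAfter_zero_apply_of_forall fun s hs ↦ hs ?_
    rw [slePointReStop_apply]
    exact ⟨(abs_lt.1 (h _)).1, (abs_lt.1 (h _)).2⟩
  rw [slePointReExitTime, htop, min_eq_right le_top]

/-- **The real part of the SLE_κ flow of `z ∈ ℍ` does not loiter**: for `κ > 0` and `R > |re z|`,
the event "`τ(z) = ∞` and `|xₜ| < R` for all `t`" (`xₜ = re(gₜ(z) - Wₜ)`) is null. On it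
`σ_{R,n} = ρₙ` for all `n` and `ρₙ ≥ t` for `n` large (`exists_le_slePointLocTime`), so it lies in
`⋃_N ⋂_{n ≥ N} {σ_{R,n} ≥ t}`, of probability `≤ (R² - (re z)²)/(κ t)` for every `t > 0`
(`measureReal_coe_le_slePointReExitTime_le`). This replaces the sprint-time estimate
"`P[τ_R > T] < ε/2`" of Rohde–Schramm's proof of Lemma 6.5. [cite: RohdeSchramm2005, Lemma 6.5 (proof)] -/
theorem measure_swallowingTime_eq_top_and_forall_abs_re_lt_eq_zero (hκ : 0 < κ) (hz : 0 < z.im)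
    (hR : |z.re| < R) :
    preWienerMeasure {ω | swallowingTime (sleDriving κ ω) z = ⊤ ∧
      ∀ s : ℝ≥0, |(centredMap (sleDriving κ ω) s z).re| < R} = 0 := by
  haveI := isProbabilityMeasure_preWienerMeasure'
  set μ : Measure (ℝ≥0 → ℝ) := preWienerMeasure with hμ
  set L : Set (ℝ≥0 → ℝ) := {ω | swallowingTime (sleDriving κ ω) z = ⊤ ∧
    ∀ s : ℝ≥0, |(centredMap (sleDriving κ ω) s z).re| < R} with hLdef
  set C : ℝ := R ^ 2 - z.re ^ 2 with hCdef
  have hκ0 : (0 : ℝ) < κ := by exact_mod_cast hκ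
  -- for every `t > 0`: `μ L ≤ C/(κ t)`
  have hbound : ∀ t : ℝ≥0, 0 < t → μ.real L ≤ C / ((κ : ℝ) * t) := by
    intro t ht
    have ht' : (0 : ℝ) < t := ht
    set B : ℕ → Set (ℝ≥0 → ℝ) := fun N ↦
      ⋂ k : ℕ, {ω | (t : WithTop ℝ≥0) ≤ slePointReExitTime κ z R (N + k) ω} with hBdef
    have hBm : ∀ N, MeasurableSet (B N) := fun N ↦ MeasurableSet.iInter fun k ↦
      brownianFiltration.le t _ ((isStoppingTime_slePointReExitTime (R := R) (n := N + k) hz).measurableSet_ge t)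
    have hBmono : Monotone B := by
      refine monotone_nat_of_le_succ fun N ω hω ↦ ?_
      simp only [hBdef, mem_iInter, mem_setOf_eq] at hω ⊢
      intro k
      have := hω (k + 1)
      rwa [show N + (k + 1) = N + 1 + k by ring] at this
    have hLB : L ⊆ ⋃ N, B N := by
      intro ω hω
      obtain ⟨hτ, habs⟩ := hω
      obtain ⟨N, hN⟩ := exists_le_slePointLocTime (κ := κ) hz ω (t := t) (by rw [hτ]; exact WithTop.coe_lt_top t)
      refine mem_iUnion.2 ⟨N, mem_iInter.2 fun k ↦ ?_⟩
      simp only [mem_setOf_eq]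
      rw [slePointReExitTime_eq_locTime_of_forall_abs_lt (fun s ↦ habs s)]
      exact hN (N + k) (Nat.le_add_right N k)
    have hBle : ∀ N, μ.real (B N) ≤ C / ((κ : ℝ) * t) := by
      intro N
      have hsub : B N ⊆ {ω | (t : WithTop ℝ≥0) ≤ slePointReExitTime κ z R N ω} := by
        intro ω hω
        simp only [hBdef, mem_iInter, mem_setOf_eq] at hω
        simpa using hω 0
      have h1 := measureReal_coe_le_slePointReExitTime_le hκ hz hR N t
      rw [le_div_iff₀ (by positivity), mul_comm]
      exact (mul_le_mul_of_nonneg_left (measureReal_mono hsub) (by positivity)).trans h1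
    -- pass to the increasing union
    have htend := tendsto_measure_iUnion_atTop (μ := μ) hBmono
    have htr := (ENNReal.tendsto_toReal (measure_ne_top _ _)).comp htend
    have hle : (μ (⋃ N, B N)).toReal ≤ C / ((κ : ℝ) * t) :=
      le_of_tendsto' htr fun N ↦ by
        change (μ (B N)).toReal ≤ C / ((κ : ℝ) * t)
        rw [← measureReal_def]
        exact hBle N
    calc μ.real L ≤ μ.real (⋃ N, B N) := measureReal_mono hLB
      _ ≤ C / ((κ : ℝ) * t) := by rw [measureReal_def]; exact hle
  -- let `t → ∞`
  have hL0 : μ.real L ≤ 0 := by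
    refine le_of_forall_pos_le_add fun ε hε ↦ ?_
    rw [zero_add]
    have hC0 : 0 ≤ C := by
      have := abs_nonneg z.re
      have h' : z.re ^ 2 < R ^ 2 := by
        calc z.re ^ 2 = |z.re| ^ 2 := (sq_abs _).symm
          _ < R ^ 2 := pow_lt_pow_left₀ hR (abs_nonneg _) two_ne_zero
      simp only [hCdef]; linarith
    -- choose `t` with `C/(κ t) ≤ ε`
    obtain ⟨m, hm⟩ := exists_nat_gt (C / ((κ : ℝ) * ε))
    have ht : (0 : ℝ≥0) < (m : ℝ≥0) + 1 := by positivity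
    refine (hbound _ ht).trans ?_
    rw [div_le_iff₀ (by positivity)]
    rw [div_lt_iff₀ (by positivity)] at hm
    push_cast
    nlinarith
  have hL0' : μ.real L = 0 := le_antisymm hL0 measureReal_nonneg
  exact (measureReal_eq_zero_iff (measure_ne_top _ _)).1 hL0'

end Literature.Probability.RandomPlanarGeometry
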